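import Summits.QuantumFields.YangMills.Theorems.BalabanUVNodesN21SelectedTopCut13CoPH
import Summits.QuantumFields.YangMills.Theorems.BalabanUVNodesN21ShellSplitOfRecord13CoPHKeyed
import Summits.QuantumFields.YangMills.Theorems.BalabanUVNodesN21StepWeightsPositivity

/-!
# N21 (NE7c) · THE SELECTED TOP CUT ON THE THRESHOLD-LETTER ROAD, AT THE `CoPH`-KEYED STAGE-13 RECORD: for the two runs OF RECORD of a comparison `K` (n20-d's
# `runA₁₃ ∕ runB₁₃ ∕ histA₁₃ ∕ histB₁₃`, tops `K₀ + K` and `K₀ + K + 1`) on the live-selector line, ONE COMMON DEPTH `i ≤ n` whose top-lettered shells weigh at most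
# `2(2L^m)⁴∕(n+1) ×` the runs' partition sums — rows: the live-selector pin and (H-ζ) ONLY ((M1)-FREE NE7c at the top-lettered terms of record)

R134 seat `pub-ymgap-dag-n21-d` (g10), node N21 = NE7c (NOT PRINTED; NOT proved at print's fixed thresholds), strategy s2; lane K3⁷ `SpineGivenEndpointR13SepCoPH`
(stmt-QuantumFields-20544, `--supports … --as helper`; COUNT-NEUTRAL).  Imports `…N21SelectedTopCut13CoPH` (§17–§19: the RT identity, the RT-pigeonhole, the selected
depths at NODE 00's generality), g9's `…N21ShellSplitOfRecord13CoPHKeyed` (p593341: `integrable_chi_mul_dressedSlots_of_ppSelLive` — F3's (e1) at EVERY level on the live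
line, from dag-n19-c's tower identity + dag-n19-d's (e1)) and this seat's (POS)-ζ module `…N21StepWeightsPositivity` (p496248: `zetaOfRecord_nonneg`).

WHAT THIS FILE PROVES (theorems only; 0 `def`, 0 `sorry`).
* §20a (NODE 00's generality) `chiSeqOfRecordAt_mul_of_le`; ★ `topClassWeight_sub_topBand_eq_lowered` — for `θ′ ≤ θ` the CORE `topClassWeight^{θ} − topBand(θ, θ′)` of a
  top-lettered term is `∫ χ_{k+1}^{θ′}(s′)·topSlot^{θ}(s′)` (front factor lowered, last (3.2) weight kept at `θ`): the definite object a consumer matching CORES reads.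
* §20 ★★★ `exists_common_depth_topBand_le_of_liveSel` — at a `CoPH`-keyed Stage-13 tuple `(F, θ, hP, g₀, os)` on the LIVE-SELECTOR LINE (`hsel`), under (H-ζ), for every
  offset `K₀`, comparison `K` with both tops positive (`kA + 1 = K₀ + K`, `kB + 1 = K₀ + K + 1`), width `ρ ≤ 1`, depth budget `n` and source `t`: SOME `i ≤ n` has
  `Σ_{s′} topBand^A(θ^A_i, θ^A_{i+1}) ≤ (2(2L^m)⁴∕(n+1))·Σ_s classWeight^A_{kA}(s)` AND `Σ_{s′} topBand^B(θ^B_i, θ^B_{i+1}) ≤ (2(2L^m)⁴∕(n+1))·Σ_s classWeight^B_{kB}(s)`,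
  `θ^X_i = ε^X_{top}(1 − ρ)^i` — the three ζ-rows are the provisos' (`hP.zetaUnity ∕ hP.zetaAbs`, `zetaOfRecord_nonneg`), (H-U) is absolute, (e1) is g9 FILE 3 §6's theorem.
* §20 ★★ `sum_topClassWeightAt_runA_eq_schemeZ_of_liveSel` ∕ `…_runB_…` — E1 ∕ E2 FOR THE TOP-LETTERED TERMS OF RECORD, EVERY LETTER: `Σ_{s′} topClassWeight^{θ}(s′) =
  schemeZ (datum.scheme g₀) os (K₀+K) t` (run A; `K₀+K+1` for run B) — T2's E1-step + dag-n19-d's E1 at every level (`…N19MGFFormAtRecordMass` v1.1 §6) BY NAME: the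
  top-lettered terms are an extraction-grade expansion of the runs' dressed partition functions (the `KeyedExtraction` rows of a top-lettered reading).
* §20 ★★★ `exists_common_depth_topBand_le_topClassWeight_of_liveSel` — the same common depth with the bounds RELATIVE TO THE TOP-LETTERED TERMS THEMSELVES:
  `Σ_{s′} topBand^X(θ_i, θ_{i+1}) ≤ (2(2L^m)⁴∕(n+1))·Σ_{s′} topClassWeight^X(θ_i)` for `X = A, B` — the `left ∕ right` fields of `T4IndicatorShell.ShellWeightBound` for a
  top-lettered reading, (M1)-FREE.

HONEST FRAMING (binding).  Bookkeeping BY NAME; NO estimate of Bałaban's; `Summable (K ↦ 1∕(n_K+1))` then makes the selected top-lettered shells' relative weights summable —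
NE7c's OUTPUT SHAPE for the top-lettered terms, at a READING not yet typed (n20-d's `crOfRecord₁₃At` pins print's `ε_K`; the top-lettered reading, its `KeyedExtraction` from
§17's RT identity, and the K3 skeleton's `PinnedAtLive` admitting it are LOCATED — plan ∕ n20-d ∕ N19′); NOT a bound at print's fixed thresholds ((M1) stands there, g9 FILES 2–7);
the top 𝐑-step omitted (integral-preserving).  No `Provisos₁₃CoPH` inhabitant claimed (K0⁷ open); NE7c NOT PRINTED ∕ NOT proved at print's thresholds; N21 NOT discharged;
K3⁷ NOT claimed; counts UNMOVED (typed 28∕28 · discharged 5∕27); never a count claim.  No `instance`, no `notation`, no `def`.  One finite four-torus programme at fixed `ε` —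
NOT ℝ⁴, NOT OS, NOT a mass gap, NOT the Clay problem.
-/

noncomputable section

open scoped BigOperators
open Finset MeasureTheory

namespace Summit.QuantumFields.YangMills.Theorems.N21ShellSplitOfRecord13CoPH

open Literature.MathematicalPhysics.QuantumFieldTheory.Balaban1983to89
open Literature.MathematicalPhysics.QuantumFieldTheory.Balaban1983to89.T4Continuum
open Literature.MathematicalPhysics.QuantumFieldTheory.Balaban1983to89.Node00
open YMDAG.UVSplit (runA₁₃ runB₁₃ histA₁₃ histB₁₃ histA₁₃_zero histB₁₃_zero)
open Summit.QuantumFields.YangMills.Theorems.N21StepWeightsPositivity (zetaOfRecord_nonneg)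
open Summit.QuantumFields.YangMills.BalabanUVNodes.N19MGFFormAtRecordMass (sum_classWeightOfDatum₉_datumOfRecord₁₃CoPH_eq_schemeZ_of_ppSelLive)

/-! ## §20a The CORE of a top-lettered term: the term with its front factor at the LOWERED letter (N19′'s object on this road, definite) -/

section Core

variable (F : T4Family) (N : ℕ) [NeZero N] (ϑ : Stage9Params F N) (D : FiniteEpsData F (SU N)) (g₀ : ℕ → ℝ) (os : List (ULoop F))
  (p : B12.RunParams) (g : ℕ → ℝ) (k : ℕ)

/-- at a lowered letter the two lettered front factors multiply to the lowered one: `δ ≤ δ′ ⇒ χ^{δ′}(s)·χ^{δ}(s) = χ^{δ}(s)` (`{0,1}`-valued, monotone in the letter). [bookkeeping] -/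
theorem chiSeqOfRecordAt_mul_of_le {δ δ' : ℝ} (h : δ ≤ δ') (j : ℕ) (s : SeqOfRecord F ϑ.ν ϑ.τ9.M g p.K j) (V : GaugeField (F.P p.K) j (SU N)) :
    chiSeqOfRecordAt F N ϑ.ν ϑ.τ9.M g p.K j δ' s V * chiSeqOfRecordAt F N ϑ.ν ϑ.τ9.M g p.K j δ s V = chiSeqOfRecordAt F N ϑ.ν ϑ.τ9.M g p.K j δ s V := by
  have hmono := chiSeqOfRecordAt_mono F N ϑ.ν ϑ.τ9.M g p.K j h s V
  have h0 := chiSeqOfRecordAt_nonneg F N ϑ.ν ϑ.τ9.M g p.K j δ s V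
  rcases chiSeqOfRecordAt_eq_zero_or_one F N ϑ p g j δ' s V with h' | h'
  · rw [h'] at hmono ⊢; rw [zero_mul]; linarith
  · rw [h', one_mul]

/-- ★ **THE CORE OF A TOP-LETTERED TERM IS THE TERM WITH ITS FRONT FACTOR AT THE LOWERED LETTER**: for `θ′ ≤ θ`,
`topClassWeight^{θ}(s′) − topBand(θ, θ′)(s′) = ∫ χ_{k+1}^{θ′}(s′)·topSlot^{θ}(s′)` — the (3.2) weight of the last step stays at `θ`, only the front factor is lowered: the
definite object a consumer matching the two runs' top-lettered CORES reads (design (i) at the selected letter).  Displayed: (H-ζ), `Σ|ζ| ≤ 1`, F3's (e1) at level `k`, `k < p.K`.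
[bookkeeping] -/
theorem topClassWeight_sub_topBand_eq_lowered (hk : k < p.K) (hζm : ZetaMeasurable F N ϑ.ζ) (hζ1 : IsZetaAbsLeOne F N ϑ.ν ϑ.τ9.M ϑ.ζ) {θ θ' : ℝ} (hθ : θ' ≤ θ)
    (t : ℝ)
    (hint : ∀ s : SeqOfRecord F ϑ.ν ϑ.τ9.M g p.K k,
      Integrable (fun U => chiSeqOfRecord F N ϑ.ν ϑ.τ9.M g p.K k s U * dressedSlotsOfDatum₉ F N ϑ D g₀ os t p g k s U) (fieldMeasure (F.P p.K) k (SU N)))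
    (s' : SeqOfRecord F ϑ.ν ϑ.τ9.M g p.K (k + 1)) :
    topClassWeightAt F N ϑ D g₀ os p g k θ t s' - topBandWeightAt F N ϑ D g₀ os p g k θ θ' t s' =
      ∫ V, chiSeqOfRecordAt F N ϑ.ν ϑ.τ9.M g p.K (k + 1) θ' s' V * topSlotAt F N ϑ D g₀ os p g k θ t s' V ∂fieldMeasure (F.P p.K) (k + 1) (SU N) := by
  unfold topClassWeightAt topBandWeightAt
  have hI := integrable_topPiece F N ϑ D g₀ os p g k hk hζm hζ1 θ θ t hint s'
  have hB : Integrable (fun V => chiSeqOfRecordAt F N ϑ.ν ϑ.τ9.M g p.K (k + 1) θ s' V * (1 - chiSeqOfRecordAt F N ϑ.ν ϑ.τ9.M g p.K (k + 1) θ' s' V) *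
      topSlotAt F N ϑ D g₀ os p g k θ t s' V) (fieldMeasure (F.P p.K) (k + 1) (SU N)) := by
    have h := hI.bdd_mul (c := 1)
      (((measurable_chiSeqOfRecordAt_of_localBg (localBgMeasurable F N ϑ.ν) ϑ.τ9.M g p.K (k + 1) θ' s').const_sub (1 : ℝ)).aestronglyMeasurable)
      (ae_of_all _ fun V => by
        have h0 := chiSeqOfRecordAt_nonneg F N ϑ.ν ϑ.τ9.M g p.K (k + 1) θ' s' V
        have h1 := chiSeqOfRecordAt_le_one F N ϑ.ν ϑ.τ9.M g p.K (k + 1) θ' s' V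
        rw [Real.norm_eq_abs, abs_le]
        constructor <;> linarith)
    refine h.congr (ae_of_all _ fun V => ?_)
    simp only
    ring
  rw [← integral_sub hI hB]
  refine integral_congr_ae (ae_of_all _ fun V => ?_)
  have hmul := chiSeqOfRecordAt_mul_of_le F N ϑ p g hθ (k + 1) s' V
  simp only
  calc chiSeqOfRecordAt F N ϑ.ν ϑ.τ9.M g p.K (k + 1) θ s' V * topSlotAt F N ϑ D g₀ os p g k θ t s' V -
        chiSeqOfRecordAt F N ϑ.ν ϑ.τ9.M g p.K (k + 1) θ s' V * (1 - chiSeqOfRecordAt F N ϑ.ν ϑ.τ9.M g p.K (k + 1) θ' s' V) *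
          topSlotAt F N ϑ D g₀ os p g k θ t s' V
      = (chiSeqOfRecordAt F N ϑ.ν ϑ.τ9.M g p.K (k + 1) θ s' V * chiSeqOfRecordAt F N ϑ.ν ϑ.τ9.M g p.K (k + 1) θ' s' V) *
          topSlotAt F N ϑ D g₀ os p g k θ t s' V := by ring
    _ = chiSeqOfRecordAt F N ϑ.ν ϑ.τ9.M g p.K (k + 1) θ' s' V * topSlotAt F N ϑ D g₀ os p g k θ t s' V := by rw [hmul]

end Core

/-! ## §20 The two runs of record on the live line: one common depth, rows = `hsel` + (H-ζ) -/

section Record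

variable {F : T4Family} {N : ℕ} [NeZero N]

/-- ★★★ **(M1)-FREE NE7c AT THE TOP-LETTERED TERMS OF THE TWO RUNS OF RECORD, ONE COMMON DEPTH** — see the file header.  Rows: the live-selector pin `hsel`, (H-ζ) `hζm`,
the letter rows `ρ ≤ 1` and the positivity of both tops; everything else (`0 ≤ ζ`, `Σ|ζ| ≤ 1`, `Σζ = 1`, (H-U), F3's (e1) at levels `kA`, `kB`) is the provisos' ∕ the tree's.
NO anti-concentration, NO estimate of Bałaban's. [bookkeeping] -/
theorem exists_common_depth_topBand_le_of_liveSel (K₀ : ℕ) (θ : Stage13HParams F N) (hP : θ.Provisos₁₃CoPH F N) (g₀ : ℕ → ℝ) (os : List (ULoop F))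
    (E : B12.RunParams → ℝ) (hsel : θ.ppSel = ppSelLiveOfRecord F N θ.ν θ.τ9 E (wOfRecord₉ F N θ.toStage9Params)) (hζm : ZetaMeasurable F N θ.ζ)
    (K kA kB : ℕ) (hkA : kA + 1 = K₀ + K) (hkB : kB + 1 = K₀ + K + 1) {ρ : ℝ} (hρ : ρ ≤ 1) (n : ℕ) (t : ℝ) :
    ∃ i ∈ Finset.range (n + 1),
      ∑ s', topBandWeightAt F N θ.toStage9Params (datumOfRecord₁₃CoPH F N θ hP) g₀ os (runA₁₃ F K₀ g₀ K) (histA₁₃ θ K₀ g₀ K) kA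
            (cutGrid θ.ν (histA₁₃ θ K₀ g₀ K) (kA + 1) ρ i) (cutGrid θ.ν (histA₁₃ θ K₀ g₀ K) (kA + 1) ρ (i + 1)) t s' ≤
          2 * (2 * (F.L : ℝ) ^ F.m) ^ 4 / (n + 1 : ℕ) *
            ∑ s, classWeightOfDatum₉ F N θ.toStage9Params (datumOfRecord₁₃CoPH F N θ hP) g₀ os (runA₁₃ F K₀ g₀ K) (histA₁₃ θ K₀ g₀ K) kA t s ∧
        ∑ s', topBandWeightAt F N θ.toStage9Params (datumOfRecord₁₃CoPH F N θ hP) g₀ os (runB₁₃ F K₀ g₀ K) (histB₁₃ θ K₀ g₀ K) kB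
            (cutGrid θ.ν (histB₁₃ θ K₀ g₀ K) (kB + 1) ρ i) (cutGrid θ.ν (histB₁₃ θ K₀ g₀ K) (kB + 1) ρ (i + 1)) t s' ≤
          2 * (2 * (F.L : ℝ) ^ F.m) ^ 4 / (n + 1 : ℕ) *
            ∑ s, classWeightOfDatum₉ F N θ.toStage9Params (datumOfRecord₁₃CoPH F N θ hP) g₀ os (runB₁₃ F K₀ g₀ K) (histB₁₃ θ K₀ g₀ K) kB t s := by
  have hζ0 : ∀ p g k s Pl Ql RS U V', 0 ≤ θ.ζ p g k s Pl Ql RS U V' :=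
    fun p g k s Pl Ql RS U V' => zetaOfRecord_nonneg F N θ.ν θ.τ9.M hP.zetaUnity hP.zetaAbs p g k s Pl Ql RS U V'
  have hU : LocalBgMeasurable F N θ.ν := localBgMeasurable F N θ.ν
  have hD : (datumOfRecord₁₃CoPH F N θ hP).AvgMeasurable := (isPrintedAveraged_datumOfRecord₁₃CoPH F N θ hP).avgMeasurable
  have hkA' : kA + 1 = (runA₁₃ F K₀ g₀ K).K := by rw [YMDAG.UVSplit.runA₁₃_K]; exact hkA
  have hkB' : kB + 1 = (runB₁₃ F K₀ g₀ K).K := by rw [YMDAG.UVSplit.runB₁₃_K]; exact hkB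
  exact exists_common_depth_topBand_le F N θ.toStage9Params (datumOfRecord₁₃CoPH F N θ hP) g₀ os (runA₁₃ F K₀ g₀ K) (histA₁₃ θ K₀ g₀ K) kA hkA'
    (runB₁₃ F K₀ g₀ K) (histB₁₃ θ K₀ g₀ K) kB hkB' hζ0 hζm hP.zetaAbs hP.zetaUnity hρ n t
    (fun s => integrable_chi_mul_dressedSlots_of_ppSelLive θ.toStage9Params E hsel hU hζm hζ0 hP.zetaAbs _ hD g₀ os (histA₁₃_zero θ K₀ g₀ K) t kA s)
    (fun s => integrable_chi_mul_dressedSlots_of_ppSelLive θ.toStage9Params E hsel hU hζm hζ0 hP.zetaAbs _ hD g₀ os (histB₁₃_zero θ K₀ g₀ K) t kB s)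

/-- ★★ **E1 FOR THE TOP-LETTERED TERMS OF RUN A OF RECORD, EVERY LETTER**: on the live-selector line, `Σ_{s′} topClassWeight^{θ}(s′) = schemeZ (datum.scheme g₀) os (K₀+K) t`
for EVERY top letter `θ` and every source `t` — T2's E1-step `sum_topClassWeightAt_eq` + dag-n19-d's E1 at every level (`sum_classWeightOfDatum₉_datumOfRecord₁₃CoPH_eq_schemeZ_of_ppSelLive`,
module B′ v1.1, BY NAME).  The top-lettered terms are an EXTRACTION-GRADE expansion of run A's dressed partition function (the `KeyedExtraction` row of a top-lettered reading).
Rows: `hsel`, (H-ζ). [bookkeeping] -/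
theorem sum_topClassWeightAt_runA_eq_schemeZ_of_liveSel (K₀ : ℕ) (θ : Stage13HParams F N) (hP : θ.Provisos₁₃CoPH F N) (g₀ : ℕ → ℝ) (os : List (ULoop F))
    (E : B12.RunParams → ℝ) (hsel : θ.ppSel = ppSelLiveOfRecord F N θ.ν θ.τ9 E (wOfRecord₉ F N θ.toStage9Params)) (hζm : ZetaMeasurable F N θ.ζ)
    (K kA : ℕ) (hkA : kA + 1 = K₀ + K) (θtop t : ℝ) :
    ∑ s', topClassWeightAt F N θ.toStage9Params (datumOfRecord₁₃CoPH F N θ hP) g₀ os (runA₁₃ F K₀ g₀ K) (histA₁₃ θ K₀ g₀ K) kA θtop t s' =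
      T4GenFunBounds.schemeZ ((datumOfRecord₁₃CoPH F N θ hP).scheme g₀) os (K₀ + K) t := by
  have hζ0 : ∀ p g k s Pl Ql RS U V', 0 ≤ θ.ζ p g k s Pl Ql RS U V' :=
    fun p g k s Pl Ql RS U V' => zetaOfRecord_nonneg F N θ.ν θ.τ9.M hP.zetaUnity hP.zetaAbs p g k s Pl Ql RS U V'
  have hU : LocalBgMeasurable F N θ.ν := localBgMeasurable F N θ.ν
  have hD : (datumOfRecord₁₃CoPH F N θ hP).AvgMeasurable := (isPrintedAveraged_datumOfRecord₁₃CoPH F N θ hP).avgMeasurable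
  have hkA' : kA + 1 = (runA₁₃ F K₀ g₀ K).K := by rw [YMDAG.UVSplit.runA₁₃_K]; exact hkA
  rw [sum_topClassWeightAt_eq F N θ.toStage9Params (datumOfRecord₁₃CoPH F N θ hP) g₀ os (runA₁₃ F K₀ g₀ K) (histA₁₃ θ K₀ g₀ K) kA hkA' hζm
    hP.zetaAbs hP.zetaUnity θtop t
    (fun s => integrable_chi_mul_dressedSlots_of_ppSelLive θ.toStage9Params E hsel hU hζm hζ0 hP.zetaAbs _ hD g₀ os (histA₁₃_zero θ K₀ g₀ K) t kA s),
    sum_classWeightOfDatum₉_datumOfRecord₁₃CoPH_eq_schemeZ_of_ppSelLive θ hP E hsel hU hζm hζ0 g₀ os (histA₁₃_zero θ K₀ g₀ K) t kA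
      (by rw [← hkA']; exact Nat.le_succ kA),
    YMDAG.UVSplit.runA₁₃_K]

/-- ★★ **E2 (run B) — the same one cutoff up**: `Σ_{s′} topClassWeight^{θ}(s′) = schemeZ (datum.scheme g₀) os (K₀+K+1) t` for EVERY top letter of run B of record. [bookkeeping] -/
theorem sum_topClassWeightAt_runB_eq_schemeZ_of_liveSel (K₀ : ℕ) (θ : Stage13HParams F N) (hP : θ.Provisos₁₃CoPH F N) (g₀ : ℕ → ℝ) (os : List (ULoop F))
    (E : B12.RunParams → ℝ) (hsel : θ.ppSel = ppSelLiveOfRecord F N θ.ν θ.τ9 E (wOfRecord₉ F N θ.toStage9Params)) (hζm : ZetaMeasurable F N θ.ζ)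
    (K kB : ℕ) (hkB : kB + 1 = K₀ + K + 1) (θtop t : ℝ) :
    ∑ s', topClassWeightAt F N θ.toStage9Params (datumOfRecord₁₃CoPH F N θ hP) g₀ os (runB₁₃ F K₀ g₀ K) (histB₁₃ θ K₀ g₀ K) kB θtop t s' =
      T4GenFunBounds.schemeZ ((datumOfRecord₁₃CoPH F N θ hP).scheme g₀) os (K₀ + K + 1) t := by
  have hζ0 : ∀ p g k s Pl Ql RS U V', 0 ≤ θ.ζ p g k s Pl Ql RS U V' :=
    fun p g k s Pl Ql RS U V' => zetaOfRecord_nonneg F N θ.ν θ.τ9.M hP.zetaUnity hP.zetaAbs p g k s Pl Ql RS U V'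
  have hU : LocalBgMeasurable F N θ.ν := localBgMeasurable F N θ.ν
  have hD : (datumOfRecord₁₃CoPH F N θ hP).AvgMeasurable := (isPrintedAveraged_datumOfRecord₁₃CoPH F N θ hP).avgMeasurable
  have hkB' : kB + 1 = (runB₁₃ F K₀ g₀ K).K := by rw [YMDAG.UVSplit.runB₁₃_K]; exact hkB
  rw [sum_topClassWeightAt_eq F N θ.toStage9Params (datumOfRecord₁₃CoPH F N θ hP) g₀ os (runB₁₃ F K₀ g₀ K) (histB₁₃ θ K₀ g₀ K) kB hkB' hζm
    hP.zetaAbs hP.zetaUnity θtop t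
    (fun s => integrable_chi_mul_dressedSlots_of_ppSelLive θ.toStage9Params E hsel hU hζm hζ0 hP.zetaAbs _ hD g₀ os (histB₁₃_zero θ K₀ g₀ K) t kB s),
    sum_classWeightOfDatum₉_datumOfRecord₁₃CoPH_eq_schemeZ_of_ppSelLive θ hP E hsel hU hζm hζ0 g₀ os (histB₁₃_zero θ K₀ g₀ K) t kB
      (by rw [← hkB']; exact Nat.le_succ kB),
    YMDAG.UVSplit.runB₁₃_K]

/-- ★★★ **NE7c's OUTPUT INEQUALITIES FOR THE TOP-LETTERED TERMS OF RECORD AT THE SELECTED COMMON DEPTH, IN THE SHAPE `Σ sh ≤ Wsh · Σ A`**: on the live-selector line, SOME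
common `i ≤ n` has, for BOTH runs of record, `Σ_{s′} topBand(θ_i, θ_{i+1}) ≤ (2(2L^m)⁴∕(n+1)) · Σ_{s′} topClassWeight^{θ_i}(s′)` — the shells are RELATIVE TO THE TOP-LETTERED TERMS
THEMSELVES at the selected letter (both sums equal the run's partition function, E1∕E2 above).  With `Σ_K 1∕(n_K+1) < ∞` these are the `left ∕ right` fields of
`T4IndicatorShell.ShellWeightBound` for a top-lettered reading; rows `hsel` + (H-ζ) only; (M1)-FREE. [bookkeeping] -/
theorem exists_common_depth_topBand_le_topClassWeight_of_liveSel (K₀ : ℕ) (θ : Stage13HParams F N) (hP : θ.Provisos₁₃CoPH F N) (g₀ : ℕ → ℝ) (os : List (ULoop F))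
    (E : B12.RunParams → ℝ) (hsel : θ.ppSel = ppSelLiveOfRecord F N θ.ν θ.τ9 E (wOfRecord₉ F N θ.toStage9Params)) (hζm : ZetaMeasurable F N θ.ζ)
    (K kA kB : ℕ) (hkA : kA + 1 = K₀ + K) (hkB : kB + 1 = K₀ + K + 1) {ρ : ℝ} (hρ : ρ ≤ 1) (n : ℕ) (t : ℝ) :
    ∃ i ∈ Finset.range (n + 1),
      ∑ s', topBandWeightAt F N θ.toStage9Params (datumOfRecord₁₃CoPH F N θ hP) g₀ os (runA₁₃ F K₀ g₀ K) (histA₁₃ θ K₀ g₀ K) kA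
            (cutGrid θ.ν (histA₁₃ θ K₀ g₀ K) (kA + 1) ρ i) (cutGrid θ.ν (histA₁₃ θ K₀ g₀ K) (kA + 1) ρ (i + 1)) t s' ≤
          2 * (2 * (F.L : ℝ) ^ F.m) ^ 4 / (n + 1 : ℕ) *
            ∑ s', topClassWeightAt F N θ.toStage9Params (datumOfRecord₁₃CoPH F N θ hP) g₀ os (runA₁₃ F K₀ g₀ K) (histA₁₃ θ K₀ g₀ K) kA
              (cutGrid θ.ν (histA₁₃ θ K₀ g₀ K) (kA + 1) ρ i) t s' ∧
        ∑ s', topBandWeightAt F N θ.toStage9Params (datumOfRecord₁₃CoPH F N θ hP) g₀ os (runB₁₃ F K₀ g₀ K) (histB₁₃ θ K₀ g₀ K) kB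
            (cutGrid θ.ν (histB₁₃ θ K₀ g₀ K) (kB + 1) ρ i) (cutGrid θ.ν (histB₁₃ θ K₀ g₀ K) (kB + 1) ρ (i + 1)) t s' ≤
          2 * (2 * (F.L : ℝ) ^ F.m) ^ 4 / (n + 1 : ℕ) *
            ∑ s', topClassWeightAt F N θ.toStage9Params (datumOfRecord₁₃CoPH F N θ hP) g₀ os (runB₁₃ F K₀ g₀ K) (histB₁₃ θ K₀ g₀ K) kB
              (cutGrid θ.ν (histB₁₃ θ K₀ g₀ K) (kB + 1) ρ i) t s' := by
  have hζ0 : ∀ p g k s Pl Ql RS U V', 0 ≤ θ.ζ p g k s Pl Ql RS U V' :=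
    fun p g k s Pl Ql RS U V' => zetaOfRecord_nonneg F N θ.ν θ.τ9.M hP.zetaUnity hP.zetaAbs p g k s Pl Ql RS U V'
  have hU : LocalBgMeasurable F N θ.ν := localBgMeasurable F N θ.ν
  have hkA' : kA + 1 = (runA₁₃ F K₀ g₀ K).K := by rw [YMDAG.UVSplit.runA₁₃_K]; exact hkA
  have hkB' : kB + 1 = (runB₁₃ F K₀ g₀ K).K := by rw [YMDAG.UVSplit.runB₁₃_K]; exact hkB
  -- E1 ∕ E2: the level-`k` partition sums and the top-lettered sums are all the runs' partition functions
  have hEA := sum_classWeightOfDatum₉_datumOfRecord₁₃CoPH_eq_schemeZ_of_ppSelLive θ hP E hsel hU hζm hζ0 g₀ os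
    (histA₁₃_zero θ K₀ g₀ K) t kA (by rw [← hkA']; exact Nat.le_succ kA)
  have hEB := sum_classWeightOfDatum₉_datumOfRecord₁₃CoPH_eq_schemeZ_of_ppSelLive θ hP E hsel hU hζm hζ0 g₀ os
    (histB₁₃_zero θ K₀ g₀ K) t kB (by rw [← hkB']; exact Nat.le_succ kB)
  obtain ⟨i, hi, hA, hB⟩ := exists_common_depth_topBand_le_of_liveSel K₀ θ hP g₀ os E hsel hζm K kA kB hkA hkB hρ n t
  -- `(runA₁₃ …).K = K₀ + K` and `(runB₁₃ …).K = K₀ + K + 1` definitionally, so the partition functions match by `Eq.trans`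
  have eA : ∑ s, classWeightOfDatum₉ F N θ.toStage9Params (datumOfRecord₁₃CoPH F N θ hP) g₀ os (runA₁₃ F K₀ g₀ K) (histA₁₃ θ K₀ g₀ K) kA t s =
      ∑ s', topClassWeightAt F N θ.toStage9Params (datumOfRecord₁₃CoPH F N θ hP) g₀ os (runA₁₃ F K₀ g₀ K) (histA₁₃ θ K₀ g₀ K) kA
        (cutGrid θ.ν (histA₁₃ θ K₀ g₀ K) (kA + 1) ρ i) t s' :=
    hEA.trans (sum_topClassWeightAt_runA_eq_schemeZ_of_liveSel K₀ θ hP g₀ os E hsel hζm K kA hkA (cutGrid θ.ν (histA₁₃ θ K₀ g₀ K) (kA + 1) ρ i) t).symm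
  have eB : ∑ s, classWeightOfDatum₉ F N θ.toStage9Params (datumOfRecord₁₃CoPH F N θ hP) g₀ os (runB₁₃ F K₀ g₀ K) (histB₁₃ θ K₀ g₀ K) kB t s =
      ∑ s', topClassWeightAt F N θ.toStage9Params (datumOfRecord₁₃CoPH F N θ hP) g₀ os (runB₁₃ F K₀ g₀ K) (histB₁₃ θ K₀ g₀ K) kB
        (cutGrid θ.ν (histB₁₃ θ K₀ g₀ K) (kB + 1) ρ i) t s' :=
    hEB.trans (sum_topClassWeightAt_runB_eq_schemeZ_of_liveSel K₀ θ hP g₀ os E hsel hζm K kB hkB (cutGrid θ.ν (histB₁₃ θ K₀ g₀ K) (kB + 1) ρ i) t).symm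
  refine ⟨i, hi, ?_, ?_⟩
  · rw [← eA]; exact hA
  · rw [← eB]; exact hB

end Record

end Summit.QuantumFields.YangMills.Theorems.N21ShellSplitOfRecord13CoPH

end
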